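import Summits.NavierStokesRegularity.NavierStokesRegularity.Theses.PlaneEnergyCeiling
import Summits.NavierStokesRegularity.NavierStokesRegularity.Theorems.BoundedPlanarEnergyRegularity.Negative.LerayHopfClauseLoadBearing
import Literature.Analysis.FluidPDE.BlowupAncientSolutionProofs

/-!
# Disproof of `PlanarEnergyZoomA` — findings: NO KILL (crux-attack cycle 1); the crux is, by pure
# logic, `PlanarEnergyLiouville → BoundedPlanarEnergyRegularity`; S → C; the zero datum is vacuous
# (¬Clay (A) fails at 0); the planar clause of the CONCLUSION is its only non-trivial content
# (constants / the in-tree `IsKNSSBlowupLimit` satisfy everything else)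

Crux work file of `PlaneEnergyCeiling.PlanarEnergyZoomA` (stmt-NavierStokesRegularity-16915, rank 5,
hypothesis `h₅` of the route's `closes`), opened by the crux-attack seat
`refuter-rattack-stmt-NavierStokesRegularity-16915-0`, 2026-08-17 (one cycle of basic attacks; there was
no earlier Disproof.lean). Everything below is sorry-free, standard axioms; no `NearMisses` section.
A later cdisprove seat EXTENDS this file (do not restart it). It imports (and cites) the sibling
crux's landed negative lemma file `Theorems/BoundedPlanarEnergyRegularity/Negative/LerayHopfClauseLoadBearing.lean`
(`planar_bound_of_zero_datum`: the planar hypothesis HOLDS at the zero datum).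

Shape (read-back, `crux_iff`): `∀ ν > 0, ∀ Clay datum u₀, PlanarHyp ν u₀ → ¬ ClayA ν u₀ → LiouvilleWitness`
where `PlanarHyp` = "every classical solution on `[0,T)` that is Leray–Hopf on `[0,T]` from `u 0 = u₀`
has planar energies bounded on `[0,T)` (every `T`)", `ClayA ν u₀` = the summit's conclusion at `u₀`,
and `LiouvilleWitness` = "there is a bounded ancient (duality-)mild solution `v` (ν = 1), measurable
slices, jointly `C^∞` on `(-∞,0) × ℝ³`, planar energies `≤ M'`, `v ≢ 0`" — a CLOSED proposition (it
mentions neither `ν` nor `u₀`).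

Attacks run and their outcome:
* elaboration rc 0 (by-name probe W.lean, 1 sorry); `aesop` / `exact?` / `intros; simp_all` do not
  close the crux; `C → S` fails `exact?` / `aesop` (Scratch.lean);
* RESTATES PROBE (§1): `S → C` in one line (`crux_of_summit`: the summit refutes the hypothesis
  `¬ ClayA`); since the conclusion is closed and is LITERALLY `¬ PlanarEnergyLiouville`
  (`liouvilleWitness_iff_not_liouville`), the crux is PROPOSITIONALLY EQUIVALENT to the implication
  between its two partner cruxes, `PlanarEnergyLiouville → BoundedPlanarEnergyRegularity`
  (`crux_iff_liouville_imp_regularity`); hence `BoundedPlanarEnergyRegularity → C`, `¬Liouville → C`,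
  the support glue `BoundedRegularityOfLiouvilleZoomA` (stmt-17966) holds outright (`glue_holds`), and
  the route's hypothesis set {APriori, Liouville, ZoomA} is equivalent to {APriori, Liouville,
  BoundedPlanarEnergyRegularity} (`route_hypotheses_iff`). Not a restatement of the summit: `C → S`
  needs `PlanarEnergyAPriori ∧ PlanarEnergyLiouville` (= `closes`);
* VACUITY / degenerate datum (§2): at `u₀ = 0` the outer hypotheses hold, `PlanarHyp ν 0` HOLDS
  (sibling lemma), but `¬ ClayA ν 0` is FALSE (rest state), so the instance is vacuous ("false → …");
  in general an instance is non-vacuous iff `u₀` is a Clay counterexample with bounded planar energies,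
  i.e. iff `BoundedPlanarEnergyRegularity` fails at `u₀` — inherent to a blow-up-extraction item;
* HYPOTHESIS MUTATION (§3): dropping `¬ ClayA` turns the crux into `¬ PlanarEnergyLiouville` exactly
  (`cruxWithoutNotClayA_iff`) — so `¬ClayA` is load-bearing MODULO Liouville
  (`cruxWithoutNotClayA_false_of_liouville`); dropping `PlanarHyp` turns it into
  `PlanarEnergyLiouville → NavierStokesRegularity` exactly (`cruxWithoutPlanarHyp_iff`) — strictly
  stronger, still S-implied, not refutable;
* MISSING NORMALISATION (§4): dropping the planar clause from the CONCLUSION makes the crux TRIVIALLY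
  TRUE (`cruxWithoutPlanarConclusion_trivial`: the constant field `e₀` is a bounded ancient duality-mild
  solution, measurable, jointly smooth, nonzero — in-tree `isBoundedAncientMildSolution_fun_const`);
  constants have planar energy `⊤` (`planarEnergy_const_eq_top`), so the planar clause is exactly what
  excludes them (and the parasitic drifts `b(t)`, which the tree's duality-form class also contains).
  Corollary for provers (`isKNSSBlowupLimit_not_sufficient`): the in-tree KNSS Prop. 6.1
  (`KNSS2009_blowup_generates_ancient_holds`, whose `∃ v, IsKNSSBlowupLimit v` is not linked to `u` and
  is discharged in tree by the constant `e₀`) does NOT deliver the conclusion — the zoom (Lemma 6.1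
  compactness + record rescaling) has to be re-run with Fatou plane by plane;
* junk: planar energy is an `lintegral` of `‖·‖ₑ²` (no Bochner junk); `M, M' : ℝ` under `ofReal`
  (harmless); `ContDiff ℝ (⊤ : ℕ∞)` = `C^∞`; the duality-form class `IsBoundedAncientMildSolution` is
  larger than KNSS's (contains `b(t)`), filtered by the planar clause; quantifier order `∃ M` per
  `(T, u, p)` as intended (`T = T*` with `u(T*) :=` weak-`L²` limit is the instance the zoom uses);
* cheapest falsifier: not finite/decidable — `¬C ⟺ PlanarEnergyLiouville ∧ ¬BoundedPlanarEnergyRegularity`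
  (a Liouville THEOREM plus a blow-up with bounded planar energies); no compute job.
-/

noncomputable section

open MeasureTheory Set Function Filter Topology
open scoped InnerProductSpace RealInnerProductSpace ContDiff ENNReal
open Literature.Analysis.FluidPDE
open Summit.NavierStokesRegularity.NavierStokesRegularity.Theses.PlaneEnergyCeiling
  (PlanarEnergyZoomA PlanarEnergyLiouville BoundedPlanarEnergyRegularity PlanarEnergyAPriori
    BoundedRegularityOfLiouvilleZoomA closes)

namespace Summit.NavierStokesRegularity.NavierStokesRegularity.Cruxes.PlanarEnergyZoomA.Disproof

set_option linter.unusedVariables false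
set_option linter.dupNamespace false

/-- Physical space. -/
local notation "ℝ³" => EuclideanSpace ℝ (Fin 3)
/-- Plane coordinates. -/
local notation "ℝ²" => EuclideanSpace ℝ (Fin 2)

/-! ## §0 The crux by name and its compact form -/

/-- The crux under attack, by name. -/
abbrev Crux : Prop := PlanarEnergyZoomA

/-- Planar kinetic energy of a field `w` through the plane `R({x₂ = c})` (inlined in the crux). -/
def planarEnergy (w : ℝ³ → ℝ³) (R : ℝ³ ≃ₗᵢ[ℝ] ℝ³) (c : ℝ) : ℝ≥0∞ :=
  ∫⁻ y : ℝ², ‖w (R (WithLp.toLp 2 ![y 0, y 1, c]))‖ₑ ^ 2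

/-- Clay (A) for ONE datum `u₀` (the summit is `∀ ν > 0, ∀ Clay datum u₀, ClayA ν u₀`). -/
def ClayA (ν : ℝ) (u₀ : ℝ³ → ℝ³) : Prop :=
  ∃ (u : ℝ → ℝ³ → ℝ³) (p : ℝ → ℝ³ → ℝ), IsSmoothOnHalfSpace u ∧ IsSmoothOnHalfSpace p ∧
    IsNavierStokesSolution ν 0 u₀ u p ∧ HasBoundedEnergy u

/-- The planar hypothesis at the datum `u₀`: every classical solution on `[0,T)` that is
Leray–Hopf on `[0,T]` from `u 0 = u₀` has planar energies bounded on `[0,T)` (every `T > 0`). -/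
def PlanarHyp (ν : ℝ) (u₀ : ℝ³ → ℝ³) : Prop :=
  ∀ (T : ℝ), 0 < T → ∀ (u : ℝ → ℝ³ → ℝ³) (p : ℝ → ℝ³ → ℝ),
    IsClassicalNSSolutionOn (Set.Ico 0 T) ν 0 u p → IsLerayHopfOn T ν 0 (u 0) u → u 0 = u₀ →
    ∃ M : ℝ, ∀ t ∈ Set.Ico 0 T, ∀ (R : ℝ³ ≃ₗᵢ[ℝ] ℝ³) (c : ℝ), planarEnergy (u t) R c ≤ ENNReal.ofReal M

/-- The conclusion of the crux — a CLOSED proposition (no `ν`, no `u₀`): a nonzero bounded ancient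
duality-mild solution (`ν = 1`), measurable slices, jointly smooth on `(-∞,0) × ℝ³`, with planar
energies bounded uniformly in `t, R, c`. -/
def LiouvilleWitness : Prop :=
  ∃ (v : ℝ → ℝ³ → ℝ³) (M' : ℝ), IsBoundedAncientMildSolution 1 v ∧
    (∀ t < 0, AEStronglyMeasurable (v t) volume) ∧
    ContDiffOn ℝ (⊤ : ℕ∞) (uncurry v) (Set.Iio 0 ×ˢ Set.univ) ∧
    (∀ t < 0, ∀ (R : ℝ³ ≃ₗᵢ[ℝ] ℝ³) (c : ℝ), planarEnergy (v t) R c ≤ ENNReal.ofReal M') ∧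
    ∃ t < 0, ∃ x, v t x ≠ 0

/-- **Compact form** (definitional read-back of the elaborated statement). -/
theorem crux_iff :
    Crux ↔ ∀ ν : ℝ, 0 < ν → ∀ u₀ : ℝ³ → ℝ³, ContDiff ℝ (⊤ : ℕ∞) u₀ → NSWave0.IsDivFree u₀ →
      HasRapidSpatialDecay u₀ → PlanarHyp ν u₀ → ¬ ClayA ν u₀ → LiouvilleWitness :=
  Iff.rfl

/-! ## §1 Logical structure: S → C, and C ⟺ (Liouville → BoundedPlanarEnergyRegularity) -/

/-- **The conclusion is literally the negation of the partner crux `PlanarEnergyLiouville`.** -/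
theorem liouvilleWitness_iff_not_liouville : LiouvilleWitness ↔ ¬ PlanarEnergyLiouville := by
  constructor
  · rintro ⟨v, M', hm, hmeas, hsm, hpb, t, ht, x, hx⟩ hL
    exact hx (hL v hm hmeas hsm ⟨M', hpb⟩ t ht x)
  · intro hL
    by_contra hW
    apply hL
    intro v hm hmeas hsm hM t ht x
    obtain ⟨M', hpb⟩ := hM
    by_contra hx
    exact hW ⟨v, M', hm, hmeas, hsm, hpb, t, ht, x, hx⟩

/-- **S → C**: the summit implies the crux (it refutes the hypothesis `¬ ClayA ν u₀`). -/
theorem crux_of_summit (hS : NavierStokesRegularity) : Crux :=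
  fun ν hν u₀ hu₀ hdiv hdec _ hA => (hA (hS ν hν u₀ hu₀ hdiv hdec)).elim

/-- **C ⟺ (PlanarEnergyLiouville → BoundedPlanarEnergyRegularity)** — pure logic: the crux is the
implication between its two partner cruxes (→ is the four lines inside `closes`; ← because the
conclusion is closed and equals `¬ PlanarEnergyLiouville`). -/
theorem crux_iff_liouville_imp_regularity :
    Crux ↔ (PlanarEnergyLiouville → BoundedPlanarEnergyRegularity) := by
  constructor
  · intro h5 h3 ν hν u₀ hu₀ hdiv hdec hpl
    by_contra hA
    obtain ⟨v, M', hm, hmeas, hsm, hpb, t, ht, x, hx⟩ := h5 ν hν u₀ hu₀ hdiv hdec hpl hA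
    exact hx (h3 v hm hmeas hsm ⟨M', hpb⟩ t ht x)
  · intro h ν hν u₀ hu₀ hdiv hdec hpl hA
    have hW : LiouvilleWitness :=
      liouvilleWitness_iff_not_liouville.2 fun h3 => hA (h h3 ν hν u₀ hu₀ hdiv hdec hpl)
    exact hW

/-- `BoundedPlanarEnergyRegularity → C` (then the hypotheses `PlanarHyp`, `¬ClayA` clash). -/
theorem crux_of_regularity (h : BoundedPlanarEnergyRegularity) : Crux :=
  crux_iff_liouville_imp_regularity.2 fun _ => h

/-- `¬ PlanarEnergyLiouville → C` (a Liouville counterexample IS the conclusion). -/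
theorem crux_of_not_liouville (h : ¬ PlanarEnergyLiouville) : Crux :=
  crux_iff_liouville_imp_regularity.2 fun h3 => (h h3).elim

/-- **C ⟺ ¬Liouville ∨ BoundedPlanarEnergyRegularity** (classical reading of the previous lemma). -/
theorem crux_iff_not_liouville_or_regularity :
    Crux ↔ (¬ PlanarEnergyLiouville ∨ BoundedPlanarEnergyRegularity) := by
  rw [crux_iff_liouville_imp_regularity]; exact imp_iff_not_or

/-- **¬C ⟺ Liouville ∧ ¬BoundedPlanarEnergyRegularity**: what a kill of the crux must produce — the
Liouville THEOREM in the planar class together with a Clay counterexample with bounded planar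
energies. Neither half is available; no cheap refutation exists. -/
theorem not_crux_iff : ¬ Crux ↔ (PlanarEnergyLiouville ∧ ¬ BoundedPlanarEnergyRegularity) := by
  rw [crux_iff_liouville_imp_regularity, Classical.not_imp]

/-- **The support glue `BoundedRegularityOfLiouvilleZoomA` (stmt-17966) holds outright** (it is the →
direction above; the same four lines sit inside `closes`). Positive, NOT landed from this seat. -/
theorem glue_holds : BoundedRegularityOfLiouvilleZoomA :=
  fun h3 h5 => crux_iff_liouville_imp_regularity.1 h5 h3

/-- **The route's hypothesis set is {APriori, Liouville, BoundedPlanarEnergyRegularity} in disguise**: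
under `PlanarEnergyLiouville`, the crux `PlanarEnergyZoomA` and the criterion crux
`BoundedPlanarEnergyRegularity` are interchangeable. -/
theorem route_hypotheses_iff :
    (PlanarEnergyAPriori ∧ PlanarEnergyLiouville ∧ PlanarEnergyZoomA) ↔
      (PlanarEnergyAPriori ∧ PlanarEnergyLiouville ∧ BoundedPlanarEnergyRegularity) := by
  constructor
  · rintro ⟨h1, h3, h5⟩
    exact ⟨h1, h3, crux_iff_liouville_imp_regularity.1 h5 h3⟩
  · rintro ⟨h1, h3, h2⟩
    exact ⟨h1, h3, crux_of_regularity h2⟩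

/-- `C → S` needs BOTH partner cruxes (this is the route's `closes`); `C → S` alone fails
`exact?` / `aesop` (Scratch.lean). -/
theorem summit_of_crux_and_partners (h₁ : PlanarEnergyAPriori) (h₃ : PlanarEnergyLiouville)
    (h₅ : Crux) : NavierStokesRegularity :=
  closes h₁ h₃ h₅

/-! ## §2 The degenerate datum `u₀ = 0`: the instance is VACUOUS (`¬ ClayA ν 0` is false) -/

/-- The zero datum decays rapidly. -/
theorem hasRapidSpatialDecay_zero : HasRapidSpatialDecay (0 : ℝ³ → ℝ³) := fun n K =>
  ⟨0, fun x => by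
    have : iteratedFDeriv ℝ n (0 : ℝ³ → ℝ³) x = 0 := by
      rw [Pi.zero_def, iteratedFDeriv_fun_zero]; rfl
    rw [this, norm_zero, mul_zero]⟩

/-- The zero datum is divergence free (Wave-0 divergence). -/
theorem isDivFree_zero : NSWave0.IsDivFree (0 : ℝ³ → ℝ³) := fun x => by
  simp [NSWave0.divergence]

/-- The zero datum is smooth. -/
theorem contDiff_zero : ContDiff ℝ (⊤ : ℕ∞) (0 : ℝ³ → ℝ³) := contDiff_const

/-- **The planar hypothesis HOLDS at the zero datum** (`ν ≥ 0`): sibling negative lemma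
`BoundedPlanarEnergyRegularityNegative.planar_bound_of_zero_datum` (energy inequality from rest ⇒
every classical Leray–Hopf field from `0` vanishes identically on `[0,T)`). -/
theorem planarHyp_zero {ν : ℝ} (hν : 0 ≤ ν) : PlanarHyp ν 0 :=
  Summit.NavierStokesRegularity.NavierStokesRegularity.Theorems.BoundedPlanarEnergyRegularityNegative.planar_bound_of_zero_datum
    hν

/-- **Clay (A) holds at the zero datum**: the rest state `u ≡ 0`, `p ≡ 0` (copied from the sibling
crux work file `Cruxes/BoundedPlanarEnergyRegularity/Disproof.lean`, `clayA_zero`). -/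
theorem clayA_zero (ν : ℝ) : ClayA ν (0 : ℝ³ → ℝ³) := by
  refine ⟨0, 0, ?_, ?_, ⟨fun t _ x => ?_, fun t _ x => ?_, rfl⟩, ⟨0, by simp, fun t _ => by simp⟩⟩
  · change ContDiffOn ℝ _ (uncurry (0 : ℝ → ℝ³ → ℝ³)) _
    exact contDiffOn_const
  · change ContDiffOn ℝ _ (uncurry (0 : ℝ → ℝ³ → ℝ)) _
    exact contDiffOn_const
  · simp [Pi.zero_def]
  · simp [NSWave0.divergence]

/-- **The second hypothesis is FALSE at the zero datum**, so the crux instance at `u₀ = 0` is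
vacuous: outer hypotheses true, `PlanarHyp ν 0` true, `¬ ClayA ν 0` false. -/
theorem not_not_clayA_zero (ν : ℝ) : ¬ ¬ ClayA ν (0 : ℝ³ → ℝ³) := fun h => h (clayA_zero ν)

/-- The instance at `u₀ = 0`, closed by `absurd` ("false → anything"). -/
theorem crux_instance_zero_vacuous (ν : ℝ) : PlanarHyp ν 0 → ¬ ClayA ν 0 → LiouvilleWitness :=
  fun _ hA => (hA (clayA_zero ν)).elim

/-- **Non-vacuity criterion.** The crux has a non-vacuous instance iff some Clay datum carries the
planar bound along all its classical Leray–Hopf solutions and fails Clay (A) — i.e. iff the partner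
crux `BoundedPlanarEnergyRegularity` FAILS. (So: if the criterion crux is true the zoom crux is
vacuously true; if it is false, the zoom crux is exactly `¬ PlanarEnergyLiouville`.) -/
theorem nonvacuous_iff_not_regularity :
    (∃ ν : ℝ, 0 < ν ∧ ∃ u₀ : ℝ³ → ℝ³, ContDiff ℝ (⊤ : ℕ∞) u₀ ∧ NSWave0.IsDivFree u₀ ∧
      HasRapidSpatialDecay u₀ ∧ PlanarHyp ν u₀ ∧ ¬ ClayA ν u₀) ↔ ¬ BoundedPlanarEnergyRegularity := by
  constructor
  · rintro ⟨ν, hν, u₀, hu₀, hdiv, hdec, hpl, hA⟩ h2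
    exact hA (h2 ν hν u₀ hu₀ hdiv hdec hpl)
  · intro h2
    by_contra hne
    apply h2
    intro ν hν u₀ hu₀ hdiv hdec hpl
    by_contra hA
    exact hne ⟨ν, hν, u₀, hu₀, hdiv, hdec, hpl, hA⟩

/-! ## §3 Hypothesis mutation -/

/-- The crux with the hypothesis `¬ ClayA ν u₀` DROPPED. -/
def CruxWithoutNotClayA : Prop :=
  ∀ ν : ℝ, 0 < ν → ∀ u₀ : ℝ³ → ℝ³, ContDiff ℝ (⊤ : ℕ∞) u₀ → NSWave0.IsDivFree u₀ →
    HasRapidSpatialDecay u₀ → PlanarHyp ν u₀ → LiouvilleWitness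

/-- **Dropping `¬ClayA` turns the crux into `¬ PlanarEnergyLiouville` exactly** (instantiate at the
zero datum, where `PlanarHyp` holds). -/
theorem cruxWithoutNotClayA_iff : CruxWithoutNotClayA ↔ ¬ PlanarEnergyLiouville := by
  rw [← liouvilleWitness_iff_not_liouville]
  constructor
  · intro h
    exact h 1 one_pos 0 contDiff_zero isDivFree_zero hasRapidSpatialDecay_zero
      (planarHyp_zero zero_le_one)
  · intro hW _ _ _ _ _ _ _
    exact hW

/-- **LOAD-BEARING modulo Liouville**: under the partner crux `PlanarEnergyLiouville` the variant
without `¬ClayA` is FALSE — any proof of the crux must use the failure of Clay (A) (it is what starts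
the blow-up / zoom), unless it disproves Liouville. -/
theorem cruxWithoutNotClayA_false_of_liouville (h3 : PlanarEnergyLiouville) : ¬ CruxWithoutNotClayA :=
  fun h => (cruxWithoutNotClayA_iff.1 h) h3

/-- The crux with the planar hypothesis `PlanarHyp ν u₀` DROPPED. -/
def CruxWithoutPlanarHyp : Prop :=
  ∀ ν : ℝ, 0 < ν → ∀ u₀ : ℝ³ → ℝ³, ContDiff ℝ (⊤ : ℕ∞) u₀ → NSWave0.IsDivFree u₀ →
    HasRapidSpatialDecay u₀ → ¬ ClayA ν u₀ → LiouvilleWitness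

/-- **Dropping `PlanarHyp` turns the crux into `PlanarEnergyLiouville → NavierStokesRegularity`
exactly** — "Liouville in the planar-energy class alone settles Clay (A)": strictly stronger than the
crux (it forgets that the zoom limit inherits bounded planar energies only from a solution that has
them), still implied by the summit, not refutable cheaply. The planar hypothesis is what makes the
crux WEAKER than this, i.e. provable by the KNSS zoom + planar Fatou. -/
theorem cruxWithoutPlanarHyp_iff :
    CruxWithoutPlanarHyp ↔ (PlanarEnergyLiouville → NavierStokesRegularity) := by
  constructor
  · intro h h3 ν hν u₀ hu₀ hdiv hdec
    by_contra hA
    exact (liouvilleWitness_iff_not_liouville.1 (h ν hν u₀ hu₀ hdiv hdec hA)) h3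
  · intro h ν hν u₀ hu₀ hdiv hdec hA
    exact liouvilleWitness_iff_not_liouville.2 fun h3 => hA (h h3 ν hν u₀ hu₀ hdiv hdec)

/-- The crux implies its `PlanarHyp`-free variant only together with `PlanarEnergyAPriori` (which
supplies `PlanarHyp` at every datum) — recorded to show where crux 2 enters. -/
theorem cruxWithoutPlanarHyp_of_crux_and_apriori (h₁ : PlanarEnergyAPriori) (h₅ : Crux) :
    CruxWithoutPlanarHyp :=
  fun ν hν u₀ hu₀ hdiv hdec hA =>
    h₅ ν hν u₀ hu₀ hdiv hdec (fun T hT u p hcl hLH h0 => h₁ ν T hν hT u p hcl hLH (h0 ▸ hdec)) hA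

/-! ## §4 Missing normalisation? The planar clause of the CONCLUSION is its only non-trivial content -/

/-- The crux with the planar-energy clause DROPPED FROM THE CONCLUSION (everything else verbatim). -/
def CruxWithoutPlanarConclusion : Prop :=
  ∀ ν : ℝ, 0 < ν → ∀ u₀ : ℝ³ → ℝ³, ContDiff ℝ (⊤ : ℕ∞) u₀ → NSWave0.IsDivFree u₀ →
    HasRapidSpatialDecay u₀ → PlanarHyp ν u₀ → ¬ ClayA ν u₀ →
    ∃ (v : ℝ → ℝ³ → ℝ³), IsBoundedAncientMildSolution 1 v ∧
      (∀ t < 0, AEStronglyMeasurable (v t) volume) ∧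
      ContDiffOn ℝ (⊤ : ℕ∞) (uncurry v) (Set.Iio 0 ×ˢ Set.univ) ∧ ∃ t < 0, ∃ x, v t x ≠ 0

/-- A nonzero vector of `ℝ³`. -/
def e₀ : ℝ³ := EuclideanSpace.single 0 1

theorem norm_e₀ : ‖e₀‖ = 1 := by simp [e₀]

theorem e₀_ne_zero : e₀ ≠ 0 := by
  intro h
  have := norm_e₀
  rw [h, norm_zero] at this
  exact zero_ne_one this

/-- **Constants inhabit the conclusion class minus the planar clause**: `v ≡ e₀` is a bounded ancient
duality-mild solution (in-tree `isBoundedAncientMildSolution_fun_const`, KNSS 2009 §1), measurable,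
jointly smooth, nonzero. -/
theorem conclusionWithoutPlanar_const :
    ∃ (v : ℝ → ℝ³ → ℝ³), IsBoundedAncientMildSolution 1 v ∧
      (∀ t < 0, AEStronglyMeasurable (v t) volume) ∧
      ContDiffOn ℝ (⊤ : ℕ∞) (uncurry v) (Set.Iio 0 ×ˢ Set.univ) ∧ ∃ t < 0, ∃ x, v t x ≠ 0 :=
  ⟨fun _ _ => e₀, isBoundedAncientMildSolution_fun_const 1 e₀, fun _ _ => aestronglyMeasurable_const,
    contDiffOn_const, -1, by norm_num, 0, e₀_ne_zero⟩

/-- **Without the planar clause in the conclusion the crux is TRIVIALLY TRUE** (constants). -/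
theorem cruxWithoutPlanarConclusion_trivial : CruxWithoutPlanarConclusion :=
  fun _ _ _ _ _ _ _ _ => conclusionWithoutPlanar_const

/-- **Constants have planar energy `⊤` through every plane** (a nonzero constant over `ℝ²`). -/
theorem planarEnergy_const_eq_top {b : ℝ³} (hb : b ≠ 0) (R : ℝ³ ≃ₗᵢ[ℝ] ℝ³) (c : ℝ) :
    planarEnergy (fun _ => b) R c = ⊤ := by
  have hne : ‖b‖ₑ ^ 2 ≠ 0 := by
    apply pow_ne_zero
    rwa [enorm_ne_zero]
  simp only [planarEnergy, lintegral_const, measure_univ_of_isAddLeftInvariant]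
  exact ENNReal.mul_top hne

/-- Hence NO constant satisfies the planar clause: the clause is exactly the filter that removes the
trivial (and parasitic) members of the duality-form bounded ancient class. -/
theorem not_planarBound_const {b : ℝ³} (hb : b ≠ 0) (M' : ℝ) :
    ¬ ∀ t < 0, ∀ (R : ℝ³ ≃ₗᵢ[ℝ] ℝ³) (c : ℝ), planarEnergy ((fun (_ : ℝ) (_ : ℝ³) => b) t) R c ≤
      ENNReal.ofReal M' := by
  intro h
  have hle := h (-1) (by norm_num) (LinearIsometryEquiv.refl ℝ ℝ³) 0
  rw [show (fun (_ : ℝ) (_ : ℝ³) => b) (-1) = fun _ => b from rfl,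
    planarEnergy_const_eq_top hb (LinearIsometryEquiv.refl ℝ ℝ³) 0] at hle
  exact ENNReal.ofReal_ne_top (top_le_iff.1 hle)

/-- **Briefing for provers: the in-tree KNSS Prop. 6.1 does not deliver the conclusion.** The
vendored `KNSS2009_blowup_generates_ancient` concludes `∃ v, IsKNSSBlowupLimit v` with `v` NOT linked
to the blowing-up solution, and is discharged in tree by the constant `e₀`
(`KNSS2009_blowup_generates_ancient_holds`); but an `IsKNSSBlowupLimit` need not have bounded planar
energies. So the planar clause — the crux's only non-trivial demand on `v` — must come from re-running
the zoom (record rescaling + Lemma 6.1 compactness) on the given `u` with Fatou plane by plane. -/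
theorem isKNSSBlowupLimit_not_sufficient :
    ∃ v : ℝ → ℝ³ → ℝ³, IsKNSSBlowupLimit v ∧
      ¬ ∃ M' : ℝ, ∀ t < 0, ∀ (R : ℝ³ ≃ₗᵢ[ℝ] ℝ³) (c : ℝ), planarEnergy (v t) R c ≤ ENNReal.ofReal M' :=
  ⟨fun _ _ => e₀, isKNSSBlowupLimit_const norm_e₀, fun ⟨M', hM'⟩ => not_planarBound_const e₀_ne_zero M' hM'⟩

end Summit.NavierStokesRegularity.NavierStokesRegularity.Cruxes.PlanarEnergyZoomA.Disproof

end
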